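import Summits.CriticalPhenomena.PercolationContinuityZ3.Theorems.PercNearOneGluingNoHeavyQuantFarGate3Assembly6
import Summits.CriticalPhenomena.PercolationContinuityZ3.Theorems.PercNearOneGluingNoHeavyQuantFarGate3Cover6Third
import HarnessLib

/-!
# QUANT lane R8, front "FAR beyond trees", layer one — THE DEGREE-THREE GATE AT THE OBSERVER: the row for every gate weight `p ≥ 1/3`

builds on p205010 (kernel theorem, internal audit signed; external expert review pending)

Support file (`--supports stmt-CriticalPhenomena-4575`), seat `prim-quant-p1` (gen 32); memos
`run/shared/lean/prim/quant/prim-quant-p1-g28/FOR-LEAD-GATE3.md` (assembly, file XX) and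
`run/shared/lean/prim/quant/prim-quant-p1-g30/FOR-LEAD-GATE3-RED8.md` §3 (the cover lemma for `p ≥ 1/3`).
Standard axioms; no sorries; no definitions.

**`Quant.farLayerOne_of_gate3_third`.**  Let `v ∈ A` be a relay of degree three whose neighbours are the observer `o` (edge weight
`p = w(o,v)`) and two relays `u₁, u₂ ∈ A` (weights `r₁, r₂`), everything else — the edges among `o, u₁, u₂`, the other relays of `A` and the rest
of the finite weighted graph — being arbitrary.  If `p ≥ 1/3`, at least one relay of `A` lies outside `{v, u₁, u₂}`, the mean number of relays
joined to `o` exceeds `2` and every cut probability `P(o ↮ a)`, `a ∈ A`, is at most `t`, then `P(#{a ∈ A : o ↔ a} ≤ 1) ≤ t` — the layer-one row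
of `Quant.FarRelayRow` at that observer.  One line: `farLayerOne_of_gate3_of_cover₆` (file XX) fed with `Gate3.cover₆_third` (file XXXIV).
The case of no outside relay (`A = {v, u₁, u₂}`) is an instance of `OneCutFive.ZeroOneThree` and is not treated here.
[cite: KozmaNitzan2024, Conjecture 3 (p. 15)]; [this work].
-/

noncomputable section

namespace Summit.CriticalPhenomena.PercolationContinuityZ3.Theorems

namespace Quant

open Finset MeasureTheory Set
open Literature.Probability.LatticeModels
open Literature.Probability.Percolation
open scoped Classical

variable {n : ℕ}

/-- **FAR(1) at every degree-three gate with gate weight `p = w(o,v) ≥ 1/3`** (at least one relay of `A` outside `{v, u₁, u₂}`;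
no condition on `r₁, r₂`, on the number of outside relays, or on the environment). [this work] -/
theorem farLayerOne_of_gate3_third (w : Sym2 (Fin n) → unitInterval) (A : Finset (Fin n)) {o v u₁ u₂ : Fin n}
    (hov : o ≠ v) (h1v : u₁ ≠ v) (h2v : u₂ ≠ v) (ho1 : o ≠ u₁) (ho2 : o ≠ u₂) (h12 : u₁ ≠ u₂)
    (hvA : v ∈ A) (h1A : u₁ ∈ A) (h2A : u₂ ∈ A)
    (hw : ∀ z : Fin n, z ≠ o → z ≠ u₁ → z ≠ u₂ → z ≠ v → (w s(v, z) : ℝ) = 0)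
    (hp : (1 : ℝ) / 3 ≤ (w s(o, v) : ℝ))
    (hout : 1 ≤ (((A.erase v).erase u₁).erase u₂).card)
    (t : ℝ) (hEN : 2 < ∑ a ∈ A, (prodBernoulli w).real (openConn o a))
    (hcut : ∀ a ∈ A, (prodBernoulli w).real (openConn o a : Set (BondConfig (Fin n)))ᶜ ≤ t) :
    (prodBernoulli w).real {ω : BondConfig (Fin n) | (A.filter fun a => ω ∈ openConn o a).card ≤ 1} ≤ t :=
  farLayerOne_of_gate3_of_cover₆ w A hov h1v h2v ho1 ho2 h12 hvA h1A h2A hw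
    (Gate3.cover₆_third (w s(o, v) : ℝ) (w s(v, u₁) : ℝ) (w s(v, u₂) : ℝ) ((((A.erase v).erase u₁).erase u₂).card : ℝ)
      hp (w s(o, v)).2.2 (w s(v, u₁)).2.1 (w s(v, u₁)).2.2 (w s(v, u₂)).2.1 (w s(v, u₂)).2.2 (by exact_mod_cast hout))
    t hEN hcut

end Quant

end Summit.CriticalPhenomena.PercolationContinuityZ3.Theorems
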